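import Literature.IUT.HodgeTheaters.PuncturedEllipticCoveringsCor12OfGeomOriginEx48
import Literature.IUT.HodgeTheaters.PuncturedEllipticCoveringsCor12InertiaCentralOfStar
import HarnessLib

/-!
# [IUTchI] Cor. 1.2 at the genuine `K`-level data — the closer of record «cor12_v12» with the law (L4) DISCHARGED from (∗):
# LAW = the six `Δ_ε` label sentences (L2a)(L2c)(L3) ×2 (proof-only knit, L5 ROWS #7 R48/R49)

Mochizuki, *Inter-universal Teichmüller theory I*, kurims manuscript (May 2020), §1 pp. 37–39, Corollary 1.2 and its proof
p. 39 l. 19–46; p. 37 l. 20–24 (the assumption (∗)) and p. 38 l. 22–24 («since [in light of the assumption (∗)!] the natural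
[outer] action of `G_k` on `Δ_ε⁺ × Gal(X̲/C̲)` is trivial») [cite: Mochizuki2012, IUTchI Cor 1.2 p.39] (D-0012 claim key; series
status DISPUTED — nothing of the series is asserted here).

PROOF-ONLY knit (cell abc-iut, seat abc-iut-L5-t1 gen 11; abc-iut-L5-lead RULINGS #118 (2) / L5 ROWS #7 R48 «COR12-KNIT» + R49
«COR12-L4-OF-STAR»; HUB census `plan/L5/SUBDAG-IUTchI-Cor12.md` §V, GAP-LEDGER G-L5t1g11-4).  ONE theorem, all by name:
abc-iut-w6-d032's closer-of-record candidate `InitialThetaData.pe_characteristicNatureOfCoverings_of_geomOrigin_ex48` (p496734)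
with its two LAW binders `hL4 hL4′` — the clause (L4) `ModLCuspLaws.inertia_central`, «`Π_X̲` centralises every cusp inertia
group modulo `Ker(Δ_X̲ ↠ Δ_X̲^{ab} ⊗ ℤ/l)`», print's consequence of (∗) via the Weil pairing — SUPPLIED by this seat's theorem
`PuncturedEllipticData.GeomOrigin.inertia_central_of_rational` (`PuncturedEllipticCoveringsCor12InertiaCentralOfStar.lean`,
p500241): (L4) ⟸ the datum's own FIELD (∗) `star` + the origin record `O` ((A) free `Δ_X`, (c′) commutator cusps) + cusp
rationality (r), through the mod-`l` Heisenberg quotient of `F̂₂`.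
DISPLAYED TELESCOPE of `InitialThetaData.pe_characteristicNatureOfCoverings_of_geomOrigin_ex48_rational`: as p496734 —
DATA `C C′ A O O′` + model data + member data + realisation data · FACT-INSTANCE `hEx` (F-0193), `h33` (F-0294), `hA hA′`
(F-0206) · CLASS SHAPE `h𝒟` · GAP `h0 h0′` (G-L5d4g6-1) — EXCEPT: `hL4 hL4′` are GONE (theorems of (∗)), replaced by the two
origin-shaped binders `hrat hrat′ : ∀ x, Function.Surjective (aug ∘ (decomp x).subtype)` («every cusp of `X̲_K` is
`K`-rational» — the shape of the EXISTING field `PuncturedEllipticData.aug_decomp_twoε`; true for [IUTchI] Def. 3.1 data,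
`K ⊇ F(E_F[l])`); **LAW = EXACTLY the six printed `Δ_ε` LABEL sentences `hL2a hL2c hL3` ×2** (route DERIVE, abc-iut-L5-d4 R45).

HONEST FRAMING: a by-name composition; origin records, model/member/realisation data and (r) are assumption-shaped DATA asserted
for no instance; typed ≠ discharged for F-0193/F-0294/F-0206 (FACT policy); nothing here bears on [IUTchIII] Cor. 3.12 or asserts
that abc is proved or refuted.  No `def`, no instance, no new `Prop` fact.
-/

noncomputable section

open CategoryTheory Topology

namespace Literature.IUT.HodgeTheaters.InitialThetaData

open scoped Pointwise
open Literature.AlgebraicGeometry.Frobenioids (IsSlimGroup)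
open Literature.AnabelianGeometry.AbsoluteAnabelian
open Literature.AnabelianGeometry.AbsoluteAnabelian.FundamentalExtension (CuspidalAlgorithm)
open Literature.AnabelianGeometry.AbsoluteAnabelian.AbsTopI (ConstructionDataClass)
open Literature.AnabelianGeometry.AbsoluteAnabelian.AbsTopII (EllipticModel)

universe u u'

variable {F : Type u} {K : Type} {Fbar : Type} [Field F] [NumberField F] [Field K] [NumberField K]
  [Algebra F K] [Field Fbar] [Algebra F Fbar] [Algebra K Fbar]
  {E : WeierstrassCurve F} [E.IsElliptic] {l : ℕ} {Pb : BadPlacePredicates K}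
  (D : InitialThetaData F K Fbar E l Pb)
  {F' : Type u'} {K' : Type} [Field F'] [NumberField F'] [Field K'] [NumberField K'] [Algebra F' K']
  {Fbar' : Type} [Field Fbar'] [Algebra F' Fbar'] [Algebra K' Fbar']
  {E' : WeierstrassCurve F'} [E'.IsElliptic] {l' : ℕ} {Pb' : BadPlacePredicates K'}
  (D' : InitialThetaData F' K' Fbar' E' l' Pb')

/-- **[IUTchI] Cor. 1.2 between the `K`-level data of two initial Θ-data — closer «cor12_v12» with (L4) DISCHARGED**:
abc-iut-w6-d032's `pe_characteristicNatureOfCoverings_of_geomOrigin_ex48` (p496734) with `hL4 hL4′` supplied by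
`PuncturedEllipticData.GeomOrigin.inertia_central_of_rational` (p500241) from the field (∗), the origin records `O O′` and cusp
rationality `hrat hrat′`.  LAW binders = the six printed `Δ_ε` label sentences (L2a)(L2c)(L3) at the two data; FACT rows F-0193,
F-0294, F-0206 by name; GAP G-L5d4g6-1; origin-shaped (r) ×2; the rest DATA.
([IUTchI] Cor 1.2 p.39) [claim: Mochizuki2012, status: disputed] -/
theorem pe_characteristicNatureOfCoverings_of_geomOrigin_ex48_rational
    (O : D.geom.pe.GeomOrigin) (O' : D'.geom.pe.GeomOrigin)
    (C : D.geom.pe.CuspGalois) (C' : D'.geom.pe.CuspGalois)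
    -- a class of [AbsTopI] Example 4.8 (i) with its named fact F-0193, a Cor 3.3/3.4 model over it, F-0294 by name
    {𝒟 : ConstructionDataClass.{0}} {p : ℕ} [Fact p.Prime] (h𝒟 : 𝒟.IsEx48ClassGen p) (hEx : 𝒟.Ex_4_8_i p)
    (M : EllipticModel 𝒟) (h33 : M.Cor_3_3_i)
    -- members X, X′ over number fields, realised by Π_{X̲→}, Π′_{X̲→} with k-cores Π_C, Π′_C
    {bX bX' : 𝒟.Base} [NumberField (𝒟.fld bX)] [NumberField (𝒟.fld bX')]
    {X : (𝒟.datum bX).Obj} {X' : (𝒟.datum bX').Obj}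
    (hmemX : 𝒟.Mem bX X) (hadmX : M.IsEllipticallyAdmissible bX X) (hΔX : IsSlimGroup ((𝒟.datum bX).ext X).geom)
    (hneX : ((𝒟.datum bX).ext X).geom ≠ ⊥) (htfgX : ((𝒟.datum bX).ext X).GeomTFG)
    (hmemX' : 𝒟.Mem bX' X') (hadmX' : M.IsEllipticallyAdmissible bX' X') (hΔX' : IsSlimGroup ((𝒟.datum bX').ext X').geom)
    (hneX' : ((𝒟.datum bX').ext X').geom ≠ ⊥) (htfgX' : ((𝒟.datum bX').ext X').GeomTFG)
    (hS : (𝒟.datum bX').primes = (𝒟.datum bX).primes)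
    (ePi : ((𝒟.datum bX).ext X).arith ≃ₜ* D.geom.pe.piXarrow) (eC : (M.coreExt bX X).arith ≃ₜ* D.geom.pe.PiC)
    (hcomp : ∀ x, eC ((M.toCore bX X).arith x) = (ePi x : D.geom.pe.PiC))
    (ePi' : ((𝒟.datum bX').ext X').arith ≃ₜ* D'.geom.pe.piXarrow) (eC' : (M.coreExt bX' X').arith ≃ₜ* D'.geom.pe.PiC)
    (hcomp' : ∀ x, eC' ((M.toCore bX' X').arith x) = (ePi' x : D'.geom.pe.PiC))
    -- members Y, Y′ over number fields, realised by Π_{C̲→}, Π′_{C̲→} with k-cores Π_C, Π′_C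
    {bY bY' : 𝒟.Base} [NumberField (𝒟.fld bY)] [NumberField (𝒟.fld bY')]
    {Y : (𝒟.datum bY).Obj} {Y' : (𝒟.datum bY').Obj}
    (hmemY : 𝒟.Mem bY Y) (hadmY : M.IsEllipticallyAdmissible bY Y) (hΔY : IsSlimGroup ((𝒟.datum bY).ext Y).geom)
    (hneY : ((𝒟.datum bY).ext Y).geom ≠ ⊥) (htfgY : ((𝒟.datum bY).ext Y).GeomTFG)
    (hmemY' : 𝒟.Mem bY' Y') (hadmY' : M.IsEllipticallyAdmissible bY' Y') (hΔY' : IsSlimGroup ((𝒟.datum bY').ext Y').geom)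
    (hneY' : ((𝒟.datum bY').ext Y').geom ≠ ⊥) (htfgY' : ((𝒟.datum bY').ext Y').GeomTFG)
    (hSY : (𝒟.datum bY').primes = (𝒟.datum bY).primes)
    (fPi : ((𝒟.datum bY).ext Y).arith ≃ₜ* D.geom.pe.piCarrow) (fC : (M.coreExt bY Y).arith ≃ₜ* D.geom.pe.PiC)
    (hcompY : ∀ x, fC ((M.toCore bY Y).arith x) = (fPi x : D.geom.pe.PiC))
    (fPi' : ((𝒟.datum bY').ext Y').arith ≃ₜ* D'.geom.pe.piCarrow) (fC' : (M.coreExt bY' Y').arith ≃ₜ* D'.geom.pe.PiC)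
    (hcompY' : ∀ x, fC' ((M.toCore bY' Y').arith x) = (fPi' x : D'.geom.pe.PiC))
    -- cusp rationality (r) at the two data (origin-shaped; the shape of the field `aug_decomp_twoε`)
    (hrat : ∀ x : D.geom.pe.Cusp,
      Function.Surjective (D.geom.pe.E.aug.toMonoidHom.comp (D.geom.pe.decomp x).subtype))
    (hrat' : ∀ x : D'.geom.pe.Cusp,
      Function.Surjective (D'.geom.pe.E.aug.toMonoidHom.comp (D'.geom.pe.decomp x).subtype))
    -- the six printed Δ_ε-level LABEL sentences (L2a)(L2c)(L3) at the two data
    (hL2a : D.geom.pe.deltaEpsKer.relIndex (D.geom.pe.inertia D.geom.pe.ε1 ⊔ D.geom.pe.deltaEpsKer) = D.geom.pe.l)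
    (hL2c : D.geom.pe.inertia D.geom.pe.ε1 ⊓ (D.geom.pe.inertia D.geom.pe.ε2 ⊔ D.geom.pe.deltaEpsKer) ≤
      D.geom.pe.deltaEpsKer)
    (hL3 : ∀ c ∈ D.geom.pe.DeltaCbar, c ∉ D.geom.pe.DeltaXbar → ∀ v ∈ D.geom.pe.DeltaXbar,
      c * v * c⁻¹ * v ∈ D.geom.pe.inertia D.geom.pe.ε1 ⊔ D.geom.pe.inertia D.geom.pe.ε2 ⊔ D.geom.pe.deltaEpsKer)
    (hL2a' : D'.geom.pe.deltaEpsKer.relIndex (D'.geom.pe.inertia D'.geom.pe.ε1 ⊔ D'.geom.pe.deltaEpsKer) =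
      D'.geom.pe.l)
    (hL2c' : D'.geom.pe.inertia D'.geom.pe.ε1 ⊓ (D'.geom.pe.inertia D'.geom.pe.ε2 ⊔ D'.geom.pe.deltaEpsKer) ≤
      D'.geom.pe.deltaEpsKer)
    (hL3' : ∀ c ∈ D'.geom.pe.DeltaCbar, c ∉ D'.geom.pe.DeltaXbar → ∀ v ∈ D'.geom.pe.DeltaXbar,
      c * v * c⁻¹ * v ∈
        D'.geom.pe.inertia D'.geom.pe.ε1 ⊔ D'.geom.pe.inertia D'.geom.pe.ε2 ⊔ D'.geom.pe.deltaEpsKer)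
    -- ramification of ε⁰ (GAP G-L5d4g6-1) and [AbsTopI] Lem 4.5 (v) (F-0206)
    (h0 : ¬ D.geom.pe.inertia D.geom.pe.ε0 ≤ D.geom.pe.piXarrow)
    (h0' : ¬ D'.geom.pe.inertia D'.geom.pe.ε0 ≤ D'.geom.pe.piXarrow)
    (A : CuspidalAlgorithm.{0}) (hA : A.RecoversCusps D.geom.pe.extXbar C.cuspidalDataXbar)
    (hA' : A.RecoversCusps D'.geom.pe.extXbar C'.cuspidalDataXbar) :
    D.geom.pe.CharacteristicNatureOfCoverings D'.geom.pe :=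
  D.pe_characteristicNatureOfCoverings_of_geomOrigin_ex48 D' O O' C C' h𝒟 hEx M h33 hmemX hadmX hΔX hneX htfgX hmemX' hadmX'
    hΔX' hneX' htfgX' hS ePi eC hcomp ePi' eC' hcomp' hmemY hadmY hΔY hneY htfgY hmemY' hadmY' hΔY' hneY' htfgY' hSY fPi fC
    hcompY fPi' fC' hcompY' hL2a hL2c hL3
    (PuncturedEllipticData.GeomOrigin.inertia_central_of_rational D.geom.pe O hrat) hL2a' hL2c' hL3'
    (PuncturedEllipticData.GeomOrigin.inertia_central_of_rational D'.geom.pe O' hrat') h0 h0' A hA hA'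

end Literature.IUT.HodgeTheaters.InitialThetaData
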